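import Literature.Barriers.CriticalPhenomena.LongRangeTrivialityOnZ3PerturbativeAudit
import Literature.Probability.LatticeModels.InfraredBoundProofs
import HarnessLib

/-!
# Discharge of the sharpened barrier `PerturbativeTrivialityOnZ3`: the infrared bound for the perturbed
# nearest-neighbour couplings `𝟙{|x-y|₁=1} + ε|x-y|₁^{-3-α}` on `ℤ³` by the torus route
# (Panis 2023, Theorem 5.5 with Remark 5.4, §3.1 and §3.6)

Sibling (proofs file) of `Literature/Barriers/CriticalPhenomena/LongRangeTrivialityOnZ3PerturbativeAudit.lean`
(barrier catalogue D-0021, sub-problem `Ising3DConformalLimit`; audit generation 7), which states the named fact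
`Literature.Barriers.CriticalPhenomena.PerturbativeTrivialityOnZ3` — every heavy-tailed perturbation
`J^{(ε,α)} = 𝟙{|x-y|₁=1} + ε|x-y|₁^{-3-α}` (`ε > 0`, `0 < α < 3/2`) of the nearest-neighbour ferromagnet on `ℤ³`
has Gaussian critical smeared scaling limits — and PROVES its reduction `PerturbativeTrivialityOnZ3.of_irb` to
ONE two-point input, the `x`-space infrared bound `HasCriticalDecay (perturbedNN ε α) (3 - α)` at `β_c`. This
file proves that input and hence **`theorem PerturbativeTrivialityOnZ3_holds : PerturbativeTrivialityOnZ3`**,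
by the tree's TORUS ROUTE (`LongRangeTrivialityOnZ3TorusRP.lean`, `LongRangeTrivialityOnZ3InfraredBoundHolds.lean`,
written there for the pure power law) run for the perturbed coupling, following the printed argument: "models …
whose couplings are linear combinations with positive coefficients of the couplings mentioned above are also
reflection-positive" [Panis, §3.1, p. 13], "reflection positivity is preserved under the addition of any nearest
neighbor term — or in fact any other RP interaction" [Aizenman–Fernández, §3, p. 45], then Proposition 3.4
(Gaussian domination on the torus), Proposition 3.8 (the `x`-space bound through the Messager–Miracle-Solé
inequalities) and the §3.6 display "there exists `C = C(d) > 0` such that for all `β ≤ β_c(ρ)`, for all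
`x ∈ ℤ^d∖{0}`, `⟨τ₀τ_x⟩_{ρ,β} ≤ C/β_c(ρ) |x|^{-(d-α∧2)}(log|x|)^{δ_{α,2}}`" for reflection-positive interactions with
`c₀k^{-1-α} ≤ ∑_{|x|=k}J_{0,x} ≤ C₀k^{-1-α}` [Panis, §3.6, p. 16] — here `d = 3`, `α < 3/2 < 2`. Everything is a
theorem; the file introduces no definition and no named fact (D-0026).

1. `ℓ¹` GEOMETRY: the unit sphere of `ℤ^d` is `{±e_j}` (`exists_eq_single_of_l1Norm_eq_one`); evenness and
   coordinate-flip invariance of `|·|₁`; summability of `J^{nn}_{0,·}`.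
2. SYMMETRIES OF PERIODISED COUPLINGS: `∑_zF(w̃'+Nz) = ∑_zF(w̃+Nz)` for `w' = proj ψ(w̃)`, `ψ` an additive
   involution of `ℤ^d` preserving `F` (`tsum_add_smul_eq_of_symmetry`); hence `J^{(N)}_{0,·}` is even and
   flip-invariant for every `ℓ¹`-radial `J` (`torusCoupling_zero_neg`, `torusCoupling_zero_update_neg`).
3. THE PERIODISED NEAREST-NEIGHBOUR COUPLING is supported on `{±ē_j}`
   (`exists_eq_single_of_torusCoupling_nn_ne_zero`) and REFLECTION POSITIVE through the bond mirrors of the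
   even torus in the form `wInfraredBound` consumes: its crossing kernel `(x,y) ↦ (J^{nn})^{(N)}_{x,Θy}` on
   `𝕋⁺ × 𝕋⁺` is DIAGONAL with nonnegative entries — a site of `𝕋⁺` adjacent to the mirror image of a site of
   `𝕋⁺` is adjacent across the mirror to its own image, `Torus.eq_reflectBetweenSites_of_adj_of_mem_of_notMem` —
   hence positive semidefinite (`torusCoupling_nn_reflectionPositive`; Panis's example (i)).
4. THE PERIODISED PERTURBED COUPLING: additivity of the periodisation (`torusCoupling_perturbedNN_zero`),
   reflection positivity as the SUM of two positive semidefinite crossing kernels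
   (`torusCoupling_perturbedNN_reflectionPositive`, with the tree's `torusCoupling_algebraic_reflectionPositive`
   for example (iii)), mirror invariance, the torus infrared bound `Ŝ_N(k) ≤ 1/(β|J|(1-Ĵ(θ_k)))`
   (`torus_twoPointFourier_le_perturbedNN`, from `wInfraredBound`), and the cube bound
   `1 - Ĵ^{(ε,α)}(q) ≥ c‖q‖^{α∧2}` on `‖q‖_∞ ≤ π` (`exists_cube_gap_lower_perturbedNN`: by Remark 3.5,
   `|J|(1 - Ĵ(q)) = ∑_x(1 - cos q·x)J_{0,x}`, the nearest-neighbour terms only increase it, and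
   `exists_cube_gap_lower` bounds the power-law part).
5. THE TORUS ROUTE WITH THE COUPLING ABSTRACTED (the proofs of `torus_sum_sum_box_le`,
   `sum_sum_pairCorrelation_le_torusRoute` and `panis_infraredBound_algebraic_beta_holds` of
   `…InfraredBoundHolds.lean`, parametrised by `J` and a torus infrared bound `Ŝ_N(k) ≤ U‖θ_k‖^{-a}` off the
   zero mode): `torus_sum_sum_box_le_of_twoPointFourier` (Parseval, Fejér envelope, Riemann sum),
   `sum_sum_pairCorrelation_le_of_torusIR` (zero mode `o(N^d)` below `β_c` since `m*(β) = 0`, Griffiths'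
   comparison free ≤ torus), `pairCorrelation_le_of_sum_sum_le` (MMS2 averaged over `Λ_{n/d}`,
   `|Λ_{n/2}|χ_{n/2} ≤ ∑_{Λ_n²}S`, left-continuity at `β_c`).
6. ASSEMBLY: `perturbedNN_infraredBound_beta` — `⟨σ₀σ_x⟩_{J^{(ε,α)},β} ≤ C/(β‖x‖^{3-α∧2})` for
   `0 < β ≤ β_c`, `x ≠ 0`, `α ≠ 2` (MMS2 is the audit's `perturbedNN_mms2`); `hasCriticalDecay_perturbedNN`;
   **`PerturbativeTrivialityOnZ3_holds`**; and the consequences of the audit made unconditional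
   (`perturbedNN_mem_bubbleBlind'`, `PerturbativeTrivialityOnZ3.no_monotone_route'`).

Scope (as in the audit's caveats): the `x`-space bound is proved with `|x| = ‖x‖_∞`, `|J|` and all constants
absorbed, for `0 < β ≤ β_c` in the tree's sense (`β_c = sInf{β > 0 | m*(β) > 0}`; if `β_c = 0` the critical state
is the product of fair signs and the decay statement is trivial); the printed logarithm at `α = 2` is not needed
(`α ≠ 2`); the torus infrared bound carries the Fröhlich–Simon–Spencer constant `1/(β|J|(1-Ĵ))` of
`wInfraredBound`, not the printed `1/(2β|J|(1-Ĵ))`.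

## References

* R. Panis, *Triviality of the scaling limits of critical Ising and `φ⁴` models with effective dimension at
  least four*, arXiv:2309.05797 (2023) = Ann. Probab. 54 (2026): §3.1 (Definition 3.1, examples (i)–(iv) and
  the sentence on positive combinations, p. 13), Proposition 3.4 and Remark 3.5 (p. 14), Proposition 3.8
  (p. 14), §3.6 (the slice assumption and the display following it, p. 16), Remark 5.4 and Theorem 5.5 (p. 21)
  [Panis2023Triviality] (held; pp. 13, 14, 16, 21 read for this file).
* M. Aizenman, R. Fernández, *Critical exponents for long-range interactions*, Lett. Math. Phys. 16 (1988)
  39–49: §3, p. 45 (examples (1)–(3) and "reflection positivity is preserved under the addition of any nearest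
  neighbor term — or in fact any other RP interaction") [AizenmanFernandez1988] (held; p. 45 read).
* S. Friedli, Y. Velenik, *Statistical Mechanics of Lattice Systems*, CUP (2017): Lemma 10.8, Example 10.10,
  Thm. 10.24 [FriedliVelenik2017] (through the tree's `InfraredBoundProofs.lean`, `WeightedInfraredBound.lean`).
* J. Fröhlich, R. Israel, E. H. Lieb, B. Simon, CMP 62 (1978) [FILS1978] (as cited there; not consulted).

## Tree anchors

`PerturbativeTrivialityOnZ3.of_irb`, `perturbedNN_mms2`, `perturbedNN_nonneg/_add/_eq_of_l1Norm_eq`,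
`perturbedNN_mem_bubbleBlind`, `l1Norm_zero_sub`, `supNorm_le_l1Norm` (`…PerturbativeAudit.lean`); `wInfraredBound`,
`convCoupling`, `couplingGap` (`WeightedInfraredBound.lean`); `torusCoupling_algebraic_reflectionPositive`,
`couplingGap_torusCoupling`, `wTwoPoint_torusCoupling`, `torusCoupling_zero_left`, `norm_centeredMomentum_le/_pos`
(`…TorusRP.lean`); `Torus.eq_reflectBetweenSites_of_adj_of_mem_of_notMem`, `Torus.mem_halfBetweenSites_iff_reflect_notMem`
(`InfraredBoundProofs.lean`); `torusGraph_adj_iff`, `Torus.proj` (`LatticeGraph.lean`); `sum_sum_box_kernel_eq_fourier`,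
`norm_sum_box_cexp_zero_sq`, `riemannSum_le`, `sum_sum_pairCorrelation_le_of_torus`, `pow_le_card_box_half'`
(`…InfraredBoundHolds.lean`); `norm_sum_box_cexp_sq_le`, `card_box_mul_boxSusceptibility_le_sum_sum`,
`div_pow_le_card_box_div` (`…InfraredBoundFourier.lean`); `exists_cube_gap_lower`, `one_sub_couplingFourier_eq`,
`couplingNorm_algebraic_pos`, `algebraicCoupling_zero_summable`, `envelope` (`…InfraredBound.lean`);
`torus_zeroMode_le_eventually`, `magnetization_eq_zero_of_lt_criticalBeta` (`…TorusZeroMode.lean`);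
`torusCoupling`, `torusLift`, `proj_eq_proj_iff`, `proj_add_eq`, `summable_coupling_add_smul`, `torusCoupling_nonneg`
(`…Torus.lean`); `card_box_mul_pairCorrelation_le_boxSusceptibility` (`…NoSlidingScale.lean`);
`tendsto_pairCorrelation_nhdsLT` (`…LeftContinuity.lean`); `boxSusceptibility_mono` (`…TwoPoint.lean`);
`state_zero_pair_eq_ite`, `criticalBeta_nonneg`, `pairCorrelation_nonneg` (`…Proofs.lean`); Mathlib:
`Equiv.tsum_eq`, `Function.Involutive.toPerm`, `Summable.tsum_le_tsum`, `Summable.tsum_add`, `Int.natAbs_eq_iff`,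
`Pi.single_neg`, `Finset.sum_eq_single_of_mem`.
-/


noncomputable section

namespace Literature.Barriers.CriticalPhenomena

open Literature.Probability.LatticeModels Literature.Probability.Percolation Filter Topology Finset
open _root_.MeasureTheory _root_.Set
open scoped symmDiff

namespace LongRangeIsing

variable {d N : ℕ}

/-- `|-v|₁ = |v|₁`. [folklore] -/
private theorem l1Norm_neg_site (v : Site d) : l1Norm (-v) = l1Norm v := by
  simp [l1Norm, Int.natAbs_neg]

/-- `|(v₁,…,-vᵢ,…,v_d)|₁ = |v|₁`. [folklore] -/
theorem l1Norm_update_neg (v : Site d) (i : Fin d) : l1Norm (Function.update v i (-v i)) = l1Norm v := by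
  unfold l1Norm
  refine Finset.sum_congr rfl fun j _ => ?_
  by_cases hj : j = i
  · subst hj; simp [Int.natAbs_neg]
  · simp [hj]

/-- **The `ℓ¹` unit sphere of `ℤ^d` consists of the `2d` vectors `±e_j`.** [folklore] -/
theorem exists_eq_single_of_l1Norm_eq_one {v : Site d} (hv : l1Norm v = 1) :
    ∃ j : Fin d, v = Pi.single j (v j) ∧ (v j = 1 ∨ v j = -1) := by
  have hv0 : v ≠ 0 := by
    rintro rfl
    simp [l1Norm] at hv
  obtain ⟨j, hj⟩ : ∃ j, v j ≠ 0 := by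
    by_contra h
    push Not at h
    exact hv0 (funext h)
  have hsplit : l1Norm v = (v j).natAbs + ∑ l ∈ univ.erase j, (v l).natAbs := by
    unfold l1Norm
    rw [← Finset.add_sum_erase _ _ (mem_univ j)]
  have h1 : 1 ≤ (v j).natAbs := Int.natAbs_pos.2 hj
  have hrest : ∑ l ∈ univ.erase j, (v l).natAbs = 0 := by omega
  have hvj : (v j).natAbs = 1 := by omega
  refine ⟨j, ?_, Int.natAbs_eq_iff.1 hvj⟩
  funext l
  by_cases hl : l = j
  · subst hl; simp
  · rw [Pi.single_eq_of_ne hl]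
    exact Int.natAbs_eq_zero.1 (Finset.sum_eq_zero_iff.1 hrest l (Finset.mem_erase.2 ⟨hl, mem_univ l⟩))

/-- The nearest-neighbour coupling is ferromagnetic (any `d`). [folklore] -/
private theorem nnCoupling_nonneg_aux (x y : Site d) : 0 ≤ nnCoupling d x y := by
  unfold nnCoupling; split_ifs <;> norm_num

/-- The nearest-neighbour coupling is translation invariant (any `d`). [folklore] -/
private theorem nnCoupling_add_aux (a x y : Site d) : nnCoupling d (x + a) (y + a) = nnCoupling d x y := by
  unfold nnCoupling; rw [add_sub_add_right_eq_sub]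

/-- `J^{nn}_{0,·}` is summable (it vanishes off `Λ₁`). [folklore] -/
theorem nnCoupling_zero_summable (d : ℕ) : Summable fun y : Site d => nnCoupling d 0 y := by
  refine summable_of_ne_finset_zero (s := box d 1) fun y hy => ?_
  have h1 : 1 < Site.supNorm y := not_le.1 fun h => hy (mem_box_iff_supNorm_le.2 h)
  have h2 : l1Norm (0 - y) ≠ 1 := by
    rw [l1Norm_zero_sub]
    have := supNorm_le_l1Norm y
    omega
  unfold nnCoupling
  rw [if_neg h2]

/-- `proj(s e_j) = s ē_j`. [folklore] -/
theorem proj_single (N : ℕ) (j : Fin d) (s : ℤ) :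
    Torus.proj N (Pi.single j s : Site d) = Pi.single j (s : ZMod N) := by
  funext i
  by_cases h : i = j
  · subst h; simp [Torus.proj]
  · simp [Torus.proj, h]

/-- `proj(Nz) = 0`. [folklore] -/
theorem proj_natCast_smul (N : ℕ) (z : Site d) : Torus.proj N ((N : ℤ) • z) = 0 := by
  funext i; simp [Torus.proj]

/-- **Sums over the periodic images are invariant under the lattice symmetries of the summand**:
if `ψ` is an additive involution of `ℤ^d` with `F ∘ ψ = F`, and `w' = proj(ψ(w̃))`, then
`∑_z F(w̃' + Nz) = ∑_z F(w̃ + Nz)`. [folklore] -/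
theorem tsum_add_smul_eq_of_symmetry [NeZero N] (F : Site d → ℝ) (ψ : Site d → Site d)
    (hadd : ∀ x y, ψ (x + y) = ψ x + ψ y) (hsmul : ∀ z : Site d, ψ ((N : ℤ) • z) = (N : ℤ) • ψ z)
    (hinv : Function.Involutive ψ) (hF : ∀ v, F (ψ v) = F v) {w w' : TorusSite d N}
    (hw : Torus.proj N (ψ (torusLift N w)) = w') :
    ∑' z : Site d, F (torusLift N w' + (N : ℤ) • z) = ∑' z : Site d, F (torusLift N w + (N : ℤ) • z) := by
  obtain ⟨c, hc⟩ : ∃ c : Site d, torusLift N w' = ψ (torusLift N w) + (N : ℤ) • c :=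
    (proj_eq_proj_iff N _ _).1 (by rw [hw, proj_torusLift])
  rw [hc]
  have h1 : ∀ z : Site d, F (ψ (torusLift N w) + (N : ℤ) • c + (N : ℤ) • z) =
      F (torusLift N w + (N : ℤ) • ψ (c + z)) := by
    intro z
    rw [← hF (torusLift N w + (N : ℤ) • ψ (c + z)), hadd, hsmul, hinv, smul_add, add_assoc]
  simp_rw [h1]
  exact ((Equiv.addLeft c).trans (hinv.toPerm ψ)).tsum_eq fun u => F (torusLift N w + (N : ℤ) • u)

/-- **`J^{(N)}_{0,·}` is even** whenever `J_{0,·}` is. [folklore] -/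
theorem torusCoupling_zero_neg [NeZero N] (J : Site d → Site d → ℝ) (hJ : ∀ v, J 0 (-v) = J 0 v)
    (w : TorusSite d N) : torusCoupling J N 0 (-w) = torusCoupling J N 0 w := by
  rw [torusCoupling_zero_left, torusCoupling_zero_left]
  refine tsum_add_smul_eq_of_symmetry (J 0) (fun v => -v) (fun x y => neg_add x y) (fun z => ?_)
    neg_involutive hJ ?_
  · rw [smul_neg]
  · funext i; simp [Torus.proj, torusLift]

/-- **`J^{(N)}_{0,·}` is invariant under the flip of one coordinate** whenever `J_{0,·}` is. [folklore] -/
theorem torusCoupling_zero_update_neg [NeZero N] (J : Site d → Site d → ℝ)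
    (hJ : ∀ (v : Site d) (i : Fin d), J 0 (Function.update v i (-v i)) = J 0 v) (i : Fin d)
    (w : TorusSite d N) :
    torusCoupling J N 0 (Function.update w i (-w i)) = torusCoupling J N 0 w := by
  rw [torusCoupling_zero_left, torusCoupling_zero_left]
  refine tsum_add_smul_eq_of_symmetry (J 0) (fun v => Function.update v i (-v i)) (fun x y => ?_)
    (fun z => ?_) (fun v => ?_) (fun v => hJ v i) ?_
  · funext j; by_cases hj : j = i
    · subst hj; simp; ring
    · simp [hj]
  · funext j; by_cases hj : j = i
    · subst hj; simp
    · simp [hj]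
  · funext j; by_cases hj : j = i
    · subst hj; simp
    · simp [hj]
  · funext j; by_cases hj : j = i
    · subst hj; simp [Torus.proj, torusLift]
    · simp [Torus.proj, torusLift, hj]

/-- **Support of the periodised nearest-neighbour coupling**: if `(J^{nn})^{(N)}_{0,w} ≠ 0` then
`w = ±ē_j` for some `j` (a periodic image of `w` is an `ℓ¹` unit vector). [folklore] -/
theorem exists_eq_single_of_torusCoupling_nn_ne_zero [NeZero N] {w : TorusSite d N}
    (h : torusCoupling (nnCoupling d) N 0 w ≠ 0) :
    ∃ j : Fin d, w = Pi.single j 1 ∨ w = -Pi.single j 1 := by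
  rw [torusCoupling_zero_left] at h
  obtain ⟨z, hz⟩ : ∃ z : Site d, nnCoupling d 0 (torusLift N w + (N : ℤ) • z) ≠ 0 := by
    by_contra hcon
    push Not at hcon
    have h0 : (fun z : Site d => nnCoupling d 0 (torusLift N w + (N : ℤ) • z)) = fun _ => 0 := funext hcon
    rw [h0, tsum_zero] at h
    exact h rfl
  set v : Site d := torusLift N w + (N : ℤ) • z with hv
  have hv1 : l1Norm v = 1 := by
    by_contra hne
    apply hz
    unfold nnCoupling
    rw [zero_sub, l1Norm_neg_site, if_neg hne]
  obtain ⟨j, hvj, hs⟩ := exists_eq_single_of_l1Norm_eq_one hv1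
  have hproj : Torus.proj N v = w := by
    rw [hv, proj_add_eq, proj_torusLift, proj_natCast_smul, add_zero]
  refine ⟨j, ?_⟩
  rcases hs with hs | hs
  · left
    rw [← hproj, hvj, hs, proj_single, Int.cast_one]
  · right
    rw [← hproj, hvj, hs, proj_single, Int.cast_neg, Int.cast_one, Pi.single_neg]

/-- **Reflection positivity of the periodised nearest-neighbour coupling** through the bond mirrors
of the even torus (hypothesis `hK` of `wInfraredBound`): the crossing kernel
`(x,y) ↦ (J^{nn})^{(N)}_{x,Θy}` on `𝕋⁺ × 𝕋⁺` is DIAGONAL — a site of `𝕋⁺` adjacent to the mirror image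
of a site of `𝕋⁺` is adjacent across the mirror to its own image
(`Torus.eq_reflectBetweenSites_of_adj_of_mem_of_notMem`) — with nonnegative entries, hence positive
semidefinite. This is example (i) of Panis's list of reflection-positive interactions.
[cite: Panis2023Triviality, §3.1 (Definition 3.1 and example (i)), p. 13] [cite: FriedliVelenik2017, Example 10.10] -/
theorem torusCoupling_nn_reflectionPositive [NeZero N] (hNe : Even N) (i : Fin d) (c : ZMod N)
    (u : TorusSite d N → ℝ) :
    0 ≤ ∑ x ∈ (Torus.halfBetweenSites i c).toFinset, ∑ y ∈ (Torus.halfBetweenSites i c).toFinset,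
      convCoupling (torusCoupling (nnCoupling d) N 0) x (Torus.reflectBetweenSites i c y) * u x * u y := by
  set P := (Torus.halfBetweenSites (d := d) (L := N) i c).toFinset with hP
  set θ := Torus.reflectBetweenSites (d := d) (L := N) i c with hθ
  set K := convCoupling (torusCoupling (nnCoupling d) N 0) with hK
  have hK0 : ∀ x y, 0 ≤ K x y := fun x y => torusCoupling_nonneg _ N nnCoupling_nonneg_aux 0 _
  have hoff : ∀ x ∈ P, ∀ y ∈ P, x ≠ y → K x (θ y) = 0 := by
    intro x hx y hy hxy
    by_contra hne
    obtain ⟨j, hj⟩ := exists_eq_single_of_torusCoupling_nn_ne_zero hne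
    have hxP : x ∈ Torus.halfBetweenSites i c := Set.mem_toFinset.1 hx
    have hyP : y ∈ Torus.halfBetweenSites i c := Set.mem_toFinset.1 hy
    have hθy : θ y ∉ Torus.halfBetweenSites i c :=
      (Torus.mem_halfBetweenSites_iff_reflect_notMem hNe i c y).1 hyP
    have hne' : x ≠ θ y := fun h => hθy (h ▸ hxP)
    have hadj : (torusGraph d N).Adj x (θ y) := by
      rw [torusGraph_adj_iff]
      refine ⟨hne', ?_⟩
      rcases hj with hj | hj
      · exact Or.inl ⟨j, by rw [← hj]; abel⟩
      · refine Or.inr ⟨j, ?_⟩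
        have : θ y - x + Pi.single j 1 = 0 := by rw [hj]; abel
        have h2 : x = θ y - x + Pi.single j 1 + x := by rw [this, zero_add]
        rw [h2]; abel
    have heq := Torus.eq_reflectBetweenSites_of_adj_of_mem_of_notMem hNe i c hadj hxP hθy
    exact hxy ((Torus.reflectBetweenSites_involutive i c).injective heq).symm
  have hdiag : ∀ x ∈ P, ∑ y ∈ P, K x (θ y) * u x * u y = K x (θ x) * u x * u x := by
    intro x hx
    rw [Finset.sum_eq_single_of_mem x hx]
    intro y hy hyx
    rw [hoff x hx y hy (Ne.symm hyx), zero_mul, zero_mul]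
  rw [Finset.sum_congr rfl hdiag]
  exact Finset.sum_nonneg fun x _ => by
    have h1 := hK0 x (θ x)
    have h2 : 0 ≤ u x * u x := mul_self_nonneg _
    nlinarith

/-! ### NEW IN PART 2: the perturbed couplings on the torus -/

variable {ε α : ℝ}

/-- `J^{(ε,α)}_{0,·}` is summable. [folklore] -/
theorem perturbedNN_zero_summable (hε : 0 ≤ ε) (hα : 0 < α) : Summable (perturbedNN ε α 0) :=
  (nnCoupling_zero_summable 3).add (algebraicCoupling_zero_summable (d := 3) (by norm_num) hε hα)

/-- `|J^{(ε,α)}| ≥ |εJ^{alg}| > 0`. [folklore] -/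
theorem couplingNorm_algebraic_le_perturbedNN (hε : 0 ≤ ε) (hα : 0 < α) :
    couplingNorm (algebraicCoupling 3 ε α) ≤ couplingNorm (perturbedNN ε α) :=
  Summable.tsum_le_tsum (fun y => le_add_of_nonneg_left (nnCoupling_nonneg_aux 0 y))
    (algebraicCoupling_zero_summable (d := 3) (by norm_num) hε hα) (perturbedNN_zero_summable hε hα)

/-- `|J^{(ε,α)}| > 0` for `ε > 0`. [folklore] -/
theorem couplingNorm_perturbedNN_pos (hε : 0 < ε) (hα : 0 < α) : 0 < couplingNorm (perturbedNN ε α) :=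
  (couplingNorm_algebraic_pos (d := 3) (by norm_num) hε hα).trans_le (couplingNorm_algebraic_le_perturbedNN hε.le hα)

/-- `J^{(ε,α)}_{0,·}` is even. [folklore] -/
theorem perturbedNN_zero_neg (ε α : ℝ) (v : Site 3) : perturbedNN ε α 0 (-v) = perturbedNN ε α 0 v :=
  perturbedNN_eq_of_l1Norm_eq ε α (by rw [zero_sub, zero_sub, neg_neg, l1Norm_neg_site])

/-- `J^{(ε,α)}_{0,·}` is invariant under coordinate flips. [folklore] -/
theorem perturbedNN_zero_update_neg (ε α : ℝ) (v : Site 3) (i : Fin 3) :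
    perturbedNN ε α 0 (Function.update v i (-v i)) = perturbedNN ε α 0 v :=
  perturbedNN_eq_of_l1Norm_eq ε α (by rw [zero_sub, zero_sub, l1Norm_neg_site, l1Norm_neg_site, l1Norm_update_neg])

/-- **The periodisation is additive**: `(J^{(ε,α)})^{(N)}_{0,w} = (J^{nn})^{(N)}_{0,w} + (εJ^{alg})^{(N)}_{0,w}`. [folklore] -/
theorem torusCoupling_perturbedNN_zero [NeZero N] (hε : 0 ≤ ε) (hα : 0 < α) (w : TorusSite 3 N) :
    torusCoupling (perturbedNN ε α) N 0 w =
      torusCoupling (nnCoupling 3) N 0 w + torusCoupling (algebraicCoupling 3 ε α) N 0 w := by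
  rw [torusCoupling_zero_left, torusCoupling_zero_left, torusCoupling_zero_left]
  have h1 := summable_coupling_add_smul (nnCoupling 3) N nnCoupling_add_aux (nnCoupling_zero_summable 3) 0 (torusLift N w)
  have h2 := summable_coupling_add_smul (algebraicCoupling 3 ε α) N (algebraicCoupling_add ε α)
    (algebraicCoupling_zero_summable (d := 3) (by norm_num) hε hα) 0 (torusLift N w)
  rw [← h1.tsum_add h2]
  rfl

/-- **Reflection positivity of the periodised perturbed coupling** — "models … whose couplings are linear
combinations with positive coefficients of the couplings mentioned above are also reflection-positive":
the crossing kernel of `(J^{(ε,α)})^{(N)}` is the sum of those of `(J^{nn})^{(N)}`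
(`torusCoupling_nn_reflectionPositive`) and of `(εJ^{alg})^{(N)}` (`torusCoupling_algebraic_reflectionPositive`).
[cite: Panis2023Triviality, §3.1 (examples (i), (iii) and the sentence on positive combinations), p. 13]
[cite: AizenmanFernandez1988, §3, p. 45 ("reflection positivity is preserved under the addition of any nearest neighbor term")] -/
theorem torusCoupling_perturbedNN_reflectionPositive (hε : 0 < ε) (hα : 0 < α) [NeZero N] (hNe : Even N)
    (hN2 : 2 ≤ N) (i : Fin 3) (c : ZMod N) (u : TorusSite 3 N → ℝ) :
    0 ≤ ∑ x ∈ (Torus.halfBetweenSites i c).toFinset, ∑ y ∈ (Torus.halfBetweenSites i c).toFinset,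
      convCoupling (torusCoupling (perturbedNN ε α) N 0) x (Torus.reflectBetweenSites i c y) * u x * u y := by
  have h1 := torusCoupling_nn_reflectionPositive (d := 3) hNe i c u
  have h2 := torusCoupling_algebraic_reflectionPositive (d := 3) (N := N) (by norm_num) hε hα hN2 i c u
  simp only [convCoupling] at h1 h2 ⊢
  simp_rw [torusCoupling_perturbedNN_zero hε.le hα, add_mul, Finset.sum_add_distrib]
  exact add_nonneg h1 h2

/-- Reflection invariance of `(J^{(ε,α)})^{(N)}` (hypothesis `hJθ` of `wInfraredBound`). [folklore] -/
theorem convCoupling_torusCoupling_perturbedNN_reflect [NeZero N] (ε α : ℝ) (i : Fin 3) (c : ZMod N)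
    (x y : TorusSite 3 N) :
    convCoupling (torusCoupling (perturbedNN ε α) N 0) (Torus.reflectBetweenSites i c x)
        (Torus.reflectBetweenSites i c y) =
      convCoupling (torusCoupling (perturbedNN ε α) N 0) x y := by
  unfold convCoupling
  have h : Torus.reflectBetweenSites i c y - Torus.reflectBetweenSites i c x =
      Function.update (y - x) i (-(y - x) i) := by
    funext j
    by_cases hj : j = i
    · subst hj
      simp only [Torus.reflectBetweenSites_apply, Pi.sub_apply, Function.update_self]
      ring
    · simp [Torus.reflectBetweenSites_apply, hj]
  rw [h, torusCoupling_zero_update_neg (perturbedNN ε α) (perturbedNN_zero_update_neg ε α)]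

/-- **The torus infrared bound for the periodised perturbed coupling** (Panis's Proposition 3.4 for
`J^{(ε,α)}`, Fröhlich–Simon–Spencer constant): `Ŝ_N(k) ≤ 1/(β|J|(1 - Ĵ(θ_k)))` on the even torus
`𝕋_N`, `N ≥ 4`, `β > 0` — Gaussian domination `wInfraredBound` with the reflection positivity
`torusCoupling_perturbedNN_reflectionPositive`. [cite: Panis2023Triviality, Proposition 3.4 and §3.1, pp. 13–14] -/
theorem torus_twoPointFourier_le_perturbedNN (hε : 0 < ε) (hα : 0 < α) [NeZero N] (hNe : Even N)
    (hN4 : 4 ≤ N) {β : ℝ} (hβ : 0 < β) {k : TorusSite 3 N}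
    (hgap : 0 < 1 - couplingFourier (perturbedNN ε α) (centeredMomentum N k)) :
    ∑ z, torusExpect (torusCoupling (perturbedNN ε α) N) β 0 (fun σ => spinAt 0 σ * spinAt z σ) *
        (torusChar k z).re ≤
      1 / (β * (couplingNorm (perturbedNN ε α) *
        (1 - couplingFourier (perturbedNN ε α) (centeredMomentum N k)))) := by
  set J := perturbedNN ε α with hJ
  have hJt : ∀ a x y, J (x + a) (y + a) = J x y := perturbedNN_add ε α
  have hJ0 : ∀ x, 0 ≤ J 0 x := fun x => perturbedNN_nonneg hε.le α 0 x
  have hJs : Summable (J 0) := perturbedNN_zero_summable hε.le hα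
  have hpos := couplingNorm_perturbedNN_pos hε hα
  have hgapE : 0 < couplingGap (torusCoupling J N 0) k := by
    rw [couplingGap_torusCoupling J hJ0 hJt hJs hpos.ne']
    exact mul_pos hpos hgap
  have hN2 : 2 ≤ N := le_trans (by norm_num) hN4
  have hj0 : ∀ w, 0 ≤ torusCoupling J N 0 w := fun w => torusCoupling_nonneg J N (perturbedNN_nonneg hε.le α) 0 w
  have hje : ∀ w, torusCoupling J N 0 (-w) = torusCoupling J N 0 w := fun w =>
    torusCoupling_zero_neg J (perturbedNN_zero_neg ε α) w
  have hJθ : ∀ (i : Fin 3) (c : ZMod N) (x y : TorusSite 3 N),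
      convCoupling (torusCoupling J N 0) (Torus.reflectBetweenSites i c x) (Torus.reflectBetweenSites i c y) =
        convCoupling (torusCoupling J N 0) x y := fun i c x y =>
    convCoupling_torusCoupling_perturbedNN_reflect ε α i c x y
  have hK : ∀ (i : Fin 3) (c : ZMod N) (u : TorusSite 3 N → ℝ),
      0 ≤ ∑ x ∈ (Torus.halfBetweenSites i c).toFinset, ∑ y ∈ (Torus.halfBetweenSites i c).toFinset,
        convCoupling (torusCoupling J N 0) x (Torus.reflectBetweenSites i c y) * u x * u y := fun i c u =>
    torusCoupling_perturbedNN_reflectionPositive hε hα hNe hN2 i c u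
  have h : ∑ z, wTwoPoint (convCoupling (torusCoupling J N 0)) β z * (torusChar k z).re ≤
      1 / (β * couplingGap (torusCoupling J N 0) k) :=
    wInfraredBound (torusCoupling J N 0) hNe hN4 hβ hj0 hje hJθ hK k hgapE
  rw [couplingGap_torusCoupling J hJ0 hJt hJs hpos.ne'] at h
  refine le_trans (le_of_eq (Finset.sum_congr rfl fun z _ => ?_)) h
  rw [wTwoPoint_torusCoupling J hJt]

/-- `(1 - cos)·J_{0,·}` is summable for summable `J_{0,·} ≥ 0`. [folklore] -/
private theorem summable_one_sub_cos_mul {J : Site d → Site d → ℝ} (hJ0 : ∀ x, 0 ≤ J 0 x) (hJs : Summable (J 0))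
    (p : Fin d → ℝ) : Summable fun x : Site d => (1 - Real.cos (phase p x)) * J 0 x := by
  refine Summable.of_nonneg_of_le (fun x => mul_nonneg (sub_nonneg.2 (Real.cos_le_one _)) (hJ0 x))
    (fun x => ?_) (hJs.mul_left 2)
  have := Real.neg_one_le_cos (phase p x)
  nlinarith [hJ0 x]

/-- **The small-momentum lower bound for the perturbed couplings** on the Brillouin cube:
`1 - Ĵ^{(ε,α)}(q) ≥ c‖q‖^{α∧2}` for `‖q‖_∞ ≤ π` (`α ≠ 2`). By Remark 3.5,
`|J^{(ε,α)}|(1 - Ĵ^{(ε,α)}(q)) = ∑_x(1 - cos q·x)J^{(ε,α)}_{0,x} ≥ ∑_x(1 - cos q·x)εJ^{alg}_{0,x} = |εJ^{alg}|(1 - Ĵ^{alg}(q))`,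
and the tree's cube bound `exists_cube_gap_lower` for the power law applies.
[cite: Panis2023Triviality, Remark 3.5 and §3.3 (1 - Ĵ(p) ≍ |p|^{α∧2}), p. 14] -/
theorem exists_cube_gap_lower_perturbedNN (hε : 0 < ε) (hα : 0 < α) (hα2 : α ≠ 2) :
    ∃ c' : ℝ, 0 < c' ∧ ∀ q : Fin 3 → ℝ, ‖q‖ ≤ Real.pi →
      c' * ‖q‖ ^ min α 2 ≤ 1 - couplingFourier (perturbedNN ε α) q := by
  obtain ⟨c, hc, hlow⟩ := exists_cube_gap_lower (d := 3) (by norm_num) hε hα hα2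
  set A : ℝ := couplingNorm (algebraicCoupling 3 ε α) with hA
  set P : ℝ := couplingNorm (perturbedNN ε α) with hP
  have hA0 : 0 < A := couplingNorm_algebraic_pos (d := 3) (by norm_num) hε hα
  have hP0 : 0 < P := couplingNorm_perturbedNN_pos hε hα
  have hJs : Summable (perturbedNN ε α 0) := perturbedNN_zero_summable hε.le hα
  have hAs : Summable (algebraicCoupling 3 ε α 0) := algebraicCoupling_zero_summable (d := 3) (by norm_num) hε.le hα
  refine ⟨c * A / P, by positivity, fun q hq => ?_⟩
  have h1 : 1 - couplingFourier (perturbedNN ε α) q =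
      (∑' x : Site 3, (1 - Real.cos (phase q x)) * perturbedNN ε α 0 x) / P :=
    one_sub_couplingFourier_eq (perturbedNN ε α) hJs hP0.ne' q
  have h2 : 1 - couplingFourier (algebraicCoupling 3 ε α) q =
      (∑' x : Site 3, (1 - Real.cos (phase q x)) * algebraicCoupling 3 ε α 0 x) / A :=
    one_sub_couplingFourier_eq (algebraicCoupling 3 ε α) hAs hA0.ne' q
  have h3 : ∑' x : Site 3, (1 - Real.cos (phase q x)) * algebraicCoupling 3 ε α 0 x ≤
      ∑' x : Site 3, (1 - Real.cos (phase q x)) * perturbedNN ε α 0 x :=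
    Summable.tsum_le_tsum
      (fun x => mul_le_mul_of_nonneg_left (le_add_of_nonneg_left (nnCoupling_nonneg_aux 0 x))
        (sub_nonneg.2 (Real.cos_le_one _)))
      (summable_one_sub_cos_mul (fun x => algebraicCoupling_nonneg hε.le α 0 x) hAs q)
      (summable_one_sub_cos_mul (fun x => perturbedNN_nonneg hε.le α 0 x) hJs q)
  have h4 := hlow q hq
  rw [h2, le_div_iff₀ hA0] at h4
  rw [h1, le_div_iff₀ hP0]
  calc c * A / P * ‖q‖ ^ min α 2 * P = c * ‖q‖ ^ min α 2 * A := by field_simp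
    _ ≤ _ := h4.trans h3

/-- The torus bound through the cube lower bound: for `k ≠ 0`, `Ŝ_N(k) ≤ ‖θ_k‖^{-(α∧2)}/(β|J|c')`.
[cite: Panis2023Triviality, Proposition 3.4 and §3.3] -/
theorem torus_twoPointFourier_le_rpow_perturbedNN (hε : 0 < ε) (hα : 0 < α) [NeZero N] (hNe : Even N)
    (hN4 : 4 ≤ N) {β : ℝ} (hβ : 0 < β) {c' : ℝ} (hc' : 0 < c')
    (hglob : ∀ q : Fin 3 → ℝ, ‖q‖ ≤ Real.pi → c' * ‖q‖ ^ min α 2 ≤ 1 - couplingFourier (perturbedNN ε α) q)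
    {k : TorusSite 3 N} (hk : k ≠ 0) :
    ∑ z, torusExpect (torusCoupling (perturbedNN ε α) N) β 0 (fun σ => spinAt 0 σ * spinAt z σ) *
        (torusChar k z).re ≤
      1 / (β * couplingNorm (perturbedNN ε α) * c') * ‖centeredMomentum N k‖ ^ (-(min α 2)) := by
  have hpos := couplingNorm_perturbedNN_pos hε hα
  have hθ := norm_centeredMomentum_pos hk
  have hlow := hglob _ (norm_centeredMomentum_le k)
  have hD : 0 < c' * ‖centeredMomentum N k‖ ^ min α 2 := mul_pos hc' (Real.rpow_pos_of_pos hθ _)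
  have hgap : 0 < 1 - couplingFourier (perturbedNN ε α) (centeredMomentum N k) := hD.trans_le hlow
  refine (torus_twoPointFourier_le_perturbedNN hε hα hNe hN4 hβ hgap).trans ?_
  rw [Real.rpow_neg hθ.le]
  calc 1 / (β * (couplingNorm (perturbedNN ε α) * (1 - couplingFourier (perturbedNN ε α) (centeredMomentum N k))))
      ≤ 1 / (β * (couplingNorm (perturbedNN ε α) * (c' * ‖centeredMomentum N k‖ ^ min α 2))) := by
        gcongr
    _ = 1 / (β * couplingNorm (perturbedNN ε α) * c') * (‖centeredMomentum N k‖ ^ min α 2)⁻¹ := by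
        field_simp

/-! ### The torus route for a general reflection-positive coupling: from a torus infrared bound off the
### zero mode to the `x`-space infrared bound (the steps of `…InfraredBoundHolds.lean`, parametrised) -/

section GenericTorusRoute

variable {d N : ℕ}

/-- **The double sum of a torus two-point function over `Λ_L × Λ_L`, zero mode plus infrared part —
for ANY coupling with a torus infrared bound off the zero mode.** If `Ŝ_N(k) ≤ U‖θ_k‖^{-a}` for all
`k ≠ 0` (`0 < a < d`), `N ≥ 14L ≥ 14`, then
`∑_{x,y∈Λ_L}G_N(x̄-ȳ) ≤ N^{-d}(∑_zG_N(z))(2L+1)^{2d} + U(9π²)^dΓ_d^dL^{d+a}`, `Γ_d = 394 + 2/(1-a/d)`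
(Parseval `sum_sum_box_kernel_eq_fourier`, the Fejér envelope `norm_sum_box_cexp_sq_le`, the Riemann-sum
bound `riemannSum_le`; the proof of `torus_sum_sum_box_le` with the coupling abstracted).
[cite: Panis2023Triviality, proof of Proposition 3.8 (χ̃_L ≤ C₃L^d∫e^{-L²‖p‖²}Ŝ(p)dp), torus version] -/
theorem torus_sum_sum_box_le_of_twoPointFourier (hd : 1 ≤ d) (J : Site d → Site d → ℝ) {a : ℝ}
    (ha0 : 0 < a) (had : a < d) [NeZero N] {L : ℕ} (hL : 1 ≤ L) (hNL : 14 * L ≤ N) (β : ℝ) {U : ℝ}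
    (hU0 : 0 ≤ U)
    (hS : ∀ k : TorusSite d N, k ≠ 0 →
      ∑ z, torusExpect (torusCoupling J N) β 0 (fun σ => spinAt 0 σ * spinAt z σ) * (torusChar k z).re ≤
        U * ‖centeredMomentum N k‖ ^ (-a)) :
    ∑ x ∈ box d L, ∑ y ∈ box d L, torusExpect (torusCoupling J N) β 0
        (fun σ => spinAt 0 σ * spinAt (Torus.proj N x - Torus.proj N y) σ) ≤
      ((N : ℝ) ^ d)⁻¹ * (∑ z, torusExpect (torusCoupling J N) β 0 (fun σ => spinAt 0 σ * spinAt z σ)) *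
          ((((2 * L + 1 : ℕ) : ℝ) ^ d) ^ 2) +
        U * ((9 * Real.pi ^ 2) ^ d * (394 + 2 / (1 - a / d)) ^ d) * (L : ℝ) ^ ((d : ℝ) + a) := by
  have hL0 : (0 : ℝ) < L := by exact_mod_cast hL
  set G : TorusSite d N → ℝ := fun z => torusExpect (torusCoupling J N) β 0 (fun σ => spinAt 0 σ * spinAt z σ) with hG
  set θ : TorusSite d N → Fin d → ℝ := centeredMomentum N with hθ
  set B : TorusSite d N → ℝ := fun k => ‖∑ x ∈ box d L, Complex.exp (Complex.I * (phase (θ k) x : ℂ))‖ ^ 2 with hB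
  set S : TorusSite d N → ℝ := fun k => ∑ z, G z * (torusChar k z).re with hS'
  -- Parseval
  have hpar : ∑ x ∈ box d L, ∑ y ∈ box d L, G (Torus.proj N x - Torus.proj N y) =
      ((N : ℝ) ^ d)⁻¹ * ∑ k, S k * B k := sum_sum_box_kernel_eq_fourier G L
  -- the zero mode
  have h0 : S 0 * B 0 = (∑ z, G z) * ((((2 * L + 1 : ℕ) : ℝ) ^ d) ^ 2) := by
    simp only [hS', hB, hθ, torusChar_zero_left, Complex.one_re, mul_one, centeredMomentum_zero]
    rw [norm_sum_box_cexp_zero_sq]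
  -- the nonzero momenta
  have hk : ∀ k ∈ Finset.univ.erase (0 : TorusSite d N),
      S k * B k ≤ U * ((9 * Real.pi ^ 2) ^ d * (L : ℝ) ^ (2 * d)) * (envelope d ((L : ℝ) • θ k) * ‖θ k‖ ^ (-a)) := by
    intro k hk
    have hk0 : k ≠ 0 := Finset.ne_of_mem_erase hk
    have hSk : S k ≤ U * ‖θ k‖ ^ (-a) := hS k hk0
    have hBk : B k ≤ (9 * Real.pi ^ 2) ^ d * (L : ℝ) ^ (2 * d) * envelope d ((L : ℝ) • θ k) :=
      norm_sum_box_cexp_sq_le hL (norm_centeredMomentum_le k)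
    have hB0 : 0 ≤ B k := sq_nonneg _
    have hbound0 : 0 ≤ U * ‖θ k‖ ^ (-a) := mul_nonneg hU0 (Real.rpow_nonneg (norm_nonneg _) _)
    calc S k * B k ≤ (U * ‖θ k‖ ^ (-a)) * B k := mul_le_mul_of_nonneg_right hSk hB0
      _ ≤ (U * ‖θ k‖ ^ (-a)) * ((9 * Real.pi ^ 2) ^ d * (L : ℝ) ^ (2 * d) * envelope d ((L : ℝ) • θ k)) :=
          mul_le_mul_of_nonneg_left hBk hbound0
      _ = U * ((9 * Real.pi ^ 2) ^ d * (L : ℝ) ^ (2 * d)) * (envelope d ((L : ℝ) • θ k) * ‖θ k‖ ^ (-a)) := by ring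
  have hR := riemannSum_le hd ha0 had hL hNL
  -- assemble
  rw [hpar, ← Finset.add_sum_erase _ _ (Finset.mem_univ (0 : TorusSite d N)), mul_add, h0]
  refine add_le_add (le_of_eq (by ring)) ?_
  calc ((N : ℝ) ^ d)⁻¹ * ∑ k ∈ Finset.univ.erase (0 : TorusSite d N), S k * B k
      ≤ ((N : ℝ) ^ d)⁻¹ * ∑ k ∈ Finset.univ.erase (0 : TorusSite d N),
          U * ((9 * Real.pi ^ 2) ^ d * (L : ℝ) ^ (2 * d)) * (envelope d ((L : ℝ) • θ k) * ‖θ k‖ ^ (-a)) :=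
        mul_le_mul_of_nonneg_left (Finset.sum_le_sum hk) (by positivity)
    _ = U * ((9 * Real.pi ^ 2) ^ d * (L : ℝ) ^ (2 * d)) *
          (((N : ℝ) ^ d)⁻¹ * ∑ k ∈ Finset.univ.erase (0 : TorusSite d N), envelope d ((L : ℝ) • θ k) * ‖θ k‖ ^ (-a)) := by
        rw [← Finset.mul_sum]; ring
    _ ≤ U * ((9 * Real.pi ^ 2) ^ d * (L : ℝ) ^ (2 * d)) * ((394 + 2 / (1 - a / d)) ^ d * (L : ℝ) ^ (a - d)) :=
        mul_le_mul_of_nonneg_left hR (by positivity)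
    _ = U * ((9 * Real.pi ^ 2) ^ d * (394 + 2 / (1 - a / d)) ^ d) * ((L : ℝ) ^ (2 * d) * (L : ℝ) ^ (a - d)) := by
        ring
    _ = U * ((9 * Real.pi ^ 2) ^ d * (394 + 2 / (1 - a / d)) ^ d) * (L : ℝ) ^ ((d : ℝ) + a) := by
        have e : (L : ℝ) ^ (2 * d) * (L : ℝ) ^ (a - d) = (L : ℝ) ^ ((d : ℝ) + a) := by
          rw [← Real.rpow_natCast, ← Real.rpow_add hL0]
          congr 1
          push_cast
          ring
        rw [e]

/-- **The Fejér-weighted double sum of the free two-point function below `β_c`, for ANY ferromagnetic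
translation-invariant summable coupling with a torus infrared bound off the zero mode** (uniform in the
even tori `𝕋_M`, `M ≥ 4`, with constant `U/β`): `∑_{x,y∈Λ_L}S_β(x-y) ≤ U(9π²)^dΓ_d^d L^{d+a}/β` for
`0 < β < β_c`, `L ≥ 1` — the zero mode is `o(M^d)` because `m*(β) = 0` below `β_c`
(`torus_zeroMode_le_eventually`), and the free state is dominated by the torus states
(`sum_sum_pairCorrelation_le_of_torus`); the proof of `sum_sum_pairCorrelation_le_torusRoute` with the
coupling abstracted. [cite: Panis2023Triviality, proof of Proposition 3.8 and Proposition 3.7 (torus version)] -/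
theorem sum_sum_pairCorrelation_le_of_torusIR (hd : 1 ≤ d) (J : Site d → Site d → ℝ)
    (hJnn : ∀ x y, 0 ≤ J x y) (hJt : ∀ a x y, J (x + a) (y + a) = J x y) (hJs : Summable (J 0))
    {a : ℝ} (ha0 : 0 < a) (had : a < d) {U : ℝ} (hU0 : 0 ≤ U)
    (hIR : ∀ (M : ℕ) [NeZero M], Even M → 4 ≤ M → ∀ (β : ℝ), 0 < β → ∀ k : TorusSite d M, k ≠ 0 →
      ∑ z, torusExpect (torusCoupling J M) β 0 (fun σ => spinAt 0 σ * spinAt z σ) * (torusChar k z).re ≤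
        U / β * ‖centeredMomentum M k‖ ^ (-a))
    {β : ℝ} (hβ : 0 < β) (hβc : β < LongRangeIsing.criticalBeta J) {L : ℕ} (hL : 1 ≤ L) :
    ∑ x ∈ box d L, ∑ y ∈ box d L, pairCorrelation J β 0 (x - y) ≤
      U * ((9 * Real.pi ^ 2) ^ d * (394 + 2 / (1 - a / d)) ^ d) * (L : ℝ) ^ ((d : ℝ) + a) / β := by
  set K : ℝ := U * ((9 * Real.pi ^ 2) ^ d * (394 + 2 / (1 - a / d)) ^ d) with hK
  have hm : magnetization J β = 0 := magnetization_eq_zero_of_lt_criticalBeta J β hβ hβc hJnn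
  have hL0 : (0 : ℝ) < L := by exact_mod_cast hL
  refine le_of_forall_pos_le_add fun ε hε => ?_
  -- the zero mode is eventually `≤ ε'N^d`, `ε' = ε/(2L+1)^{2d}`
  set V : ℝ := (((2 * L + 1 : ℕ) : ℝ) ^ d) ^ 2 with hV
  have hV0 : 0 < V := by positivity
  obtain ⟨N₀, hN₀⟩ := torus_zeroMode_le_eventually J β hd hβ hJnn hJt hJs hm (show 0 < ε / V by positivity)
  refine sum_sum_pairCorrelation_le_of_torus J β hβ.le hJnn hJt hJs (N₀ := max N₀ (14 * L)) fun M _ hM hMe => ?_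
  have hM14 : 14 * L ≤ M := le_of_max_le_right hM
  have hM4 : 4 ≤ M := by omega
  have hMd : (0 : ℝ) < (M : ℝ) ^ d := by
    have : (0 : ℝ) < M := by exact_mod_cast (show 0 < M by omega)
    positivity
  have hzero := hN₀ M (le_of_max_le_left hM)
  have hU' : 0 ≤ U / β := div_nonneg hU0 hβ.le
  have hmain := torus_sum_sum_box_le_of_twoPointFourier hd J ha0 had hL hM14 β hU'
    (fun k hk => hIR M hMe hM4 β hβ k hk)
  refine hmain.trans ?_
  rw [add_comm]
  refine add_le_add (le_of_eq ?_) ?_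
  · rw [hK]; field_simp
  · calc ((M : ℝ) ^ d)⁻¹ * (∑ z, torusExpect (torusCoupling J M) β 0 (fun σ => spinAt 0 σ * spinAt z σ)) * V
        ≤ ((M : ℝ) ^ d)⁻¹ * (ε / V * (M : ℝ) ^ d) * V :=
          mul_le_mul_of_nonneg_right (mul_le_mul_of_nonneg_left hzero (by positivity)) hV0.le
      _ = ε := by field_simp

/-- **The `x`-space infrared bound from the double-sum bound and MMS2** (the `x`-space step of the printed
proof of Proposition 3.8, with left-continuity at `β_c`; the proof of
`panis_infraredBound_algebraic_beta_holds` with the coupling abstracted): if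
`∑_{x,y∈Λ_L}S_β(x-y) ≤ KL^{d+a}/β` for `0 < β < β_c`, `L ≥ 1`, and `S_β(v) ≤ S_β(u)` whenever
`‖v‖ ≥ d‖u‖` (`β > 0`), then `S_β(x) ≤ Kd^d/(β‖x‖^{d-a})` for all `0 < β ≤ β_c`, `x ≠ 0`.
[cite: Panis2023Triviality, proof of Proposition 3.8 (last paragraph) and §3.3] -/
theorem pairCorrelation_le_of_sum_sum_le (hd2 : 2 ≤ d) (J : Site d → Site d → ℝ) (hJnn : ∀ x y, 0 ≤ J x y)
    {a K : ℝ}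
    (hsum : ∀ (β : ℝ), 0 < β → β < LongRangeIsing.criticalBeta J → ∀ (L : ℕ), 1 ≤ L →
      ∑ x ∈ box d L, ∑ y ∈ box d L, pairCorrelation J β 0 (x - y) ≤ K * (L : ℝ) ^ ((d : ℝ) + a) / β)
    (hmms : ∀ (β : ℝ), 0 < β → ∀ u v : Site d, (d : ℝ) * ‖u‖ ≤ ‖v‖ →
      pairCorrelation J β 0 v ≤ pairCorrelation J β 0 u)
    {β : ℝ} (hβ : 0 < β) (hββc : β ≤ LongRangeIsing.criticalBeta J) {x : Site d} (hx : x ≠ 0) :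
    pairCorrelation J β 0 x ≤ K * (d : ℝ) ^ d / (β * ‖x‖ ^ ((d : ℝ) - a)) := by
  have hd : 1 ≤ d := by omega
  set C : ℝ := K * (d : ℝ) ^ d with hCdef
  set n : ℕ := Site.supNorm x with hndef
  have hxn : ‖x‖ = n := Site.norm_eq_supNorm x
  have hn1 : 1 ≤ n := Nat.one_le_iff_ne_zero.2 fun h => hx (Site.supNorm_eq_zero_iff.1 h)
  have hn0 : (0 : ℝ) < n := by exact_mod_cast hn1
  have hd0 : (0 : ℝ) < d := by exact_mod_cast hd
  rw [hxn]
  -- the bound below `β_c`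
  have hsub : ∀ β', 0 < β' → β' < LongRangeIsing.criticalBeta J →
      pairCorrelation J β' 0 x ≤ C / (β' * (n : ℝ) ^ ((d : ℝ) - a)) := by
    intro β' hβ' hβ'c
    have h1 : (#(box d (n / d)) : ℝ) * pairCorrelation J β' 0 x ≤ boxSusceptibility J β' (n / d) :=
      card_box_mul_pairCorrelation_le_boxSusceptibility J β' (hmms β' hβ') (by rw [hndef]; exact Nat.mul_div_le _ d)
    have h2 : boxSusceptibility J β' (n / d) ≤ boxSusceptibility J β' (n / 2) :=
      boxSusceptibility_mono J β' hβ'.le hJnn (Nat.div_le_div_left (by omega) two_pos)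
    have h3 : (#(box d (n / 2)) : ℝ) * boxSusceptibility J β' (n / 2) ≤
        ∑ u ∈ box d n, ∑ v ∈ box d n, pairCorrelation J β' 0 (u - v) :=
      card_box_mul_boxSusceptibility_le_sum_sum J β' hβ'.le hJnn (Nat.mul_div_le n 2 |> fun h => by omega)
    have h4 := hsum β' hβ' hβ'c n hn1
    have hc1 : ((n : ℝ)) ^ d ≤ #(box d (n / 2)) := pow_le_card_box_half' d n
    have hc2 : ((n : ℝ) / d) ^ d ≤ #(box d (n / d)) := div_pow_le_card_box_div hd n
    have hcpos1 : (0 : ℝ) < #(box d (n / 2)) := lt_of_lt_of_le (by positivity) hc1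
    have hS := pairCorrelation_nonneg J β' hβ'.le hJnn 0 x
    have h6 : (#(box d (n / 2)) : ℝ) * ((#(box d (n / d)) : ℝ) * pairCorrelation J β' 0 x) ≤
        K * (n : ℝ) ^ ((d : ℝ) + a) / β' :=
      (mul_le_mul_of_nonneg_left (h1.trans h2) hcpos1.le).trans (h3.trans h4)
    have h7 : (n : ℝ) ^ d * (((n : ℝ) / d) ^ d * pairCorrelation J β' 0 x) ≤ K * (n : ℝ) ^ ((d : ℝ) + a) / β' := by
      refine le_trans ?_ h6
      exact mul_le_mul hc1 (mul_le_mul_of_nonneg_right hc2 hS) (by positivity) hcpos1.le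
    have hnd : (0 : ℝ) < (n : ℝ) ^ d * ((n : ℝ) / d) ^ d := by positivity
    rw [← mul_assoc] at h7
    have h8 : pairCorrelation J β' 0 x ≤ K * (n : ℝ) ^ ((d : ℝ) + a) / β' / ((n : ℝ) ^ d * ((n : ℝ) / d) ^ d) :=
      (le_div_iff₀' hnd).2 h7
    refine h8.trans (le_of_eq ?_)
    have e1 : (n : ℝ) ^ ((d : ℝ) + a) = (n : ℝ) ^ d * (n : ℝ) ^ a := by
      rw [Real.rpow_add hn0, Real.rpow_natCast]
    have e2 : (n : ℝ) ^ ((d : ℝ) - a) * (n : ℝ) ^ a = (n : ℝ) ^ d := by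
      rw [← Real.rpow_add hn0, sub_add_cancel, Real.rpow_natCast]
    have hna : (n : ℝ) ^ a ≠ 0 := (Real.rpow_pos_of_pos hn0 _).ne'
    have hnda : (n : ℝ) ^ ((d : ℝ) - a) ≠ 0 := (Real.rpow_pos_of_pos hn0 _).ne'
    rw [hCdef, e1, div_pow]
    field_simp
    linear_combination K * e2
  -- `β < β_c` or `β = β_c` (left-continuity)
  rcases hββc.lt_or_eq with hlt | heq
  · exact hsub β hβ hlt
  · have hβc : 0 < LongRangeIsing.criticalBeta J := hβ.trans_le hββc
    rw [heq]
    have hlim := tendsto_pairCorrelation_nhdsLT J hJnn hβc (0 : Site d) x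
    have hR : Tendsto (fun β' : ℝ => C / (β' * (n : ℝ) ^ ((d : ℝ) - a))) (𝓝[<] LongRangeIsing.criticalBeta J)
        (𝓝 (C / (LongRangeIsing.criticalBeta J * (n : ℝ) ^ ((d : ℝ) - a)))) := by
      refine (ContinuousAt.tendsto ?_).mono_left nhdsWithin_le_nhds
      refine continuousAt_const.div (continuousAt_id.mul continuousAt_const) ?_
      exact mul_ne_zero hβc.ne' (Real.rpow_pos_of_pos hn0 _).ne'
    refine le_of_tendsto_of_tendsto hlim hR ?_
    filter_upwards [Ioo_mem_nhdsLT hβc] with β' hβ'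
    exact hsub β' hβ'.1 hβ'.2

end GenericTorusRoute


/-! ### The `x`-space infrared bound for the perturbed couplings and the discharge -/

section PerturbedInfrared

variable {ε α : ℝ}

/-- **The infrared bound for the perturbed nearest-neighbour couplings, with the factor `1/β`**: for
`J^{(ε,α)} = 𝟙{|x-y|₁=1} + ε|x-y|₁^{-3-α}` on `ℤ³` (`ε > 0`, `α > 0`, `α ≠ 2`) there is `C` with
`⟨σ₀σ_x⟩_{J^{(ε,α)},β} ≤ C/(β‖x‖^{3-α∧2})` for all `0 < β ≤ β_c(J^{(ε,α)})`, `x ≠ 0` — Panis's §3.6 display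
for this reflection-positive interaction with algebraically decaying slices, by the tree's torus route:
reflection positivity of the periodised coupling (`torusCoupling_perturbedNN_reflectionPositive`), Gaussian
domination (`torus_twoPointFourier_le_perturbedNN`), the cube bound `1 - Ĵ ≥ c‖q‖^{α∧2}`
(`exists_cube_gap_lower_perturbedNN`), the vanishing torus zero mode below `β_c` and Griffiths' comparison
(`sum_sum_pairCorrelation_le_of_torusIR`), MMS2 (`perturbedNN_mms2`) and left-continuity at `β_c`
(`pairCorrelation_le_of_sum_sum_le`).
[cite: Panis2023Triviality, §3.6 (display following Proposition 3.23, p. 16) with Propositions 3.4, 3.8 and Remark 5.4] -/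
theorem perturbedNN_infraredBound_beta (hε : 0 < ε) (hα : 0 < α) (hα2 : α ≠ 2) :
    ∃ C : ℝ, 0 < C ∧ ∀ (β : ℝ), 0 < β → β ≤ LongRangeIsing.criticalBeta (perturbedNN ε α) →
      ∀ (x : Site 3), x ≠ 0 →
        pairCorrelation (perturbedNN ε α) β 0 x ≤ C / (β * ‖x‖ ^ ((3 : ℝ) - min α 2)) := by
  obtain ⟨c', hc', hglob⟩ := exists_cube_gap_lower_perturbedNN hε hα hα2
  have hpos := couplingNorm_perturbedNN_pos hε hα
  set U : ℝ := 1 / (couplingNorm (perturbedNN ε α) * c') with hU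
  have hU0 : 0 < U := by positivity
  set a : ℝ := min α 2 with ha
  have ha0 : 0 < a := lt_min hα two_pos
  have ha2 : a ≤ 2 := min_le_right α 2
  have had : a < ((3 : ℕ) : ℝ) := by push_cast; linarith
  set K : ℝ := U * ((9 * Real.pi ^ 2) ^ 3 * (394 + 2 / (1 - a / ((3 : ℕ) : ℝ))) ^ 3) with hK
  have hK0 : 0 < K := by
    have : 0 < 1 - a / ((3 : ℕ) : ℝ) := by push_cast; linarith
    positivity
  have hIR : ∀ (M : ℕ) [NeZero M], Even M → 4 ≤ M → ∀ (β : ℝ), 0 < β → ∀ k : TorusSite 3 M, k ≠ 0 →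
      ∑ z, torusExpect (torusCoupling (perturbedNN ε α) M) β 0 (fun σ => spinAt 0 σ * spinAt z σ) * (torusChar k z).re ≤
        U / β * ‖centeredMomentum M k‖ ^ (-a) := by
    intro M _ hMe hM4 β hβ k hk
    refine (torus_twoPointFourier_le_rpow_perturbedNN hε hα hMe hM4 hβ hc' hglob hk).trans (le_of_eq ?_)
    rw [hU, ← ha]
    field_simp
  have hsum : ∀ (β : ℝ), 0 < β → β < LongRangeIsing.criticalBeta (perturbedNN ε α) → ∀ (L : ℕ), 1 ≤ L →
      ∑ x ∈ box 3 L, ∑ y ∈ box 3 L, pairCorrelation (perturbedNN ε α) β 0 (x - y) ≤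
        K * (L : ℝ) ^ (((3 : ℕ) : ℝ) + a) / β :=
    fun β hβ hβc L hL => sum_sum_pairCorrelation_le_of_torusIR (d := 3) (by norm_num) (perturbedNN ε α)
      (perturbedNN_nonneg hε.le α)
      (perturbedNN_add ε α) (perturbedNN_zero_summable hε.le hα) ha0 had hU0.le hIR hβ hβc hL
  have hmms : ∀ (β : ℝ), 0 < β → ∀ u v : Site 3, ((3 : ℕ) : ℝ) * ‖u‖ ≤ ‖v‖ →
      pairCorrelation (perturbedNN ε α) β 0 v ≤ pairCorrelation (perturbedNN ε α) β 0 u :=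
    fun β hβ u v huv => perturbedNN_mms2 hε.le hα.le hβ.le (by exact_mod_cast huv)
  refine ⟨K * ((3 : ℕ) : ℝ) ^ 3, by positivity, fun β hβ hββc x hx => ?_⟩
  have h := pairCorrelation_le_of_sum_sum_le (d := 3) (by norm_num) (perturbedNN ε α) (perturbedNN_nonneg hε.le α)
    hsum hmms hβ hββc hx
  push_cast at h ⊢
  exact h

/-- **Power-law critical decay of the perturbed models**: `⟨σ₀σ_x⟩_{β_c(J^{(ε,α)})} ≤ C‖x‖^{-(3-α)}` for
`ε > 0`, `0 < α < 2` — the input `HasCriticalDecay (perturbedNN ε α) (3 - α)` of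
`PerturbativeTrivialityOnZ3.of_irb` (`perturbedNN_infraredBound_beta` at `β = β_c` when `β_c > 0`; if the
tree's `β_c` vanished the state would be the product of fair signs).
[cite: Panis2023Triviality, §3.6 (display following Proposition 3.23, p. 16) and Remark 5.4 (p. 21)] -/
theorem hasCriticalDecay_perturbedNN (hε : 0 < ε) (hα : 0 < α) (hα2 : α < 2) :
    HasCriticalDecay (perturbedNN ε α) (3 - α) := by
  set J := perturbedNN ε α with hJ
  rcases (criticalBeta_nonneg J).eq_or_lt with h0 | hpos
  · refine ⟨0, fun x hx => ?_⟩
    rw [pairCorrelation_eq, ← h0, state_zero_pair_eq_ite J 0 x, if_neg (Ne.symm hx), zero_div]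
  · obtain ⟨C, _, hirb⟩ := perturbedNN_infraredBound_beta hε hα hα2.ne
    refine ⟨C / LongRangeIsing.criticalBeta J, fun x hx => ?_⟩
    have h1 := hirb (LongRangeIsing.criticalBeta J) hpos le_rfl x hx
    rw [min_eq_left hα2.le] at h1
    rwa [div_div]

end PerturbedInfrared

end LongRangeIsing

open LongRangeIsing

/-- **DISCHARGE of the sharpened barrier `PerturbativeTrivialityOnZ3`** (Panis 2023, Theorem 5.5 with
Remark 5.4 for the reflection-positive interactions `J^{(ε,α)} = 𝟙{|x-y|₁=1} + ε|x-y|₁^{-3-α}`, `ε > 0`,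
`0 < α < 3/2`, on `ℤ³`): every such heavy-tailed perturbation of the nearest-neighbour ferromagnet has
Gaussian critical smeared scaling limits. The one input left open by the audit, the `x`-space infrared
bound `HasCriticalDecay (perturbedNN ε α) (3 - α)` (`PerturbativeTrivialityOnZ3.of_irb`), is
`hasCriticalDecay_perturbedNN`: reflection positivity of the periodised perturbed coupling on the even tori
— the nearest-neighbour crossing kernel is diagonal (`torusCoupling_nn_reflectionPositive`) and the
power-law one is positive semidefinite by the Laplace representation (`torusCoupling_algebraic_reflectionPositive`),
"reflection positivity is preserved under the addition of any nearest neighbor term" — then Gaussian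
domination, the cube bound `1 - Ĵ^{(ε,α)} ≥ c‖q‖^α` (Remark 3.5: the nearest-neighbour terms only increase
`|J|(1 - Ĵ)`), the torus route of `LongRangeTrivialityOnZ3InfraredBoundHolds.lean` with the coupling
abstracted, MMS2 and left-continuity.
[cite: Panis2023Triviality, Theorem 5.5 and Remark 5.4 (p. 21), §3.1 (p. 13), §3.6 (p. 16)]
[cite: AizenmanFernandez1988, §3, p. 45] -/
theorem PerturbativeTrivialityOnZ3_holds : PerturbativeTrivialityOnZ3 :=
  PerturbativeTrivialityOnZ3.of_irb fun _ _ hε hα hα' => hasCriticalDecay_perturbedNN hε hα (by linarith)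

/-- The perturbed models are in the bubble-blind class unconditionally (`perturbedNN_mem_bubbleBlind` with its
infrared input discharged). [cite: Panis2023Triviality, Theorem 5.5 and Theorem 12.2] -/
theorem perturbedNN_mem_bubbleBlind' {ε α : ℝ} (hε : 0 < ε) (hα : 0 < α) (hα' : α < 3 / 2) :
    (∀ x y, 0 ≤ perturbedNN ε α x y) ∧ (∀ a x y, perturbedNN ε α (x + a) (y + a) = perturbedNN ε α x y) ∧
    (0 < LongRangeIsing.criticalBeta (perturbedNN ε α) → ∀ x y : Site 3, (3 : ℝ) * ‖x‖ ≤ ‖y‖ →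
      pairCorrelation (perturbedNN ε α) (LongRangeIsing.criticalBeta (perturbedNN ε α)) 0 y ≤
        pairCorrelation (perturbedNN ε α) (LongRangeIsing.criticalBeta (perturbedNN ε α)) 0 x) ∧
    (Summable fun x : Site 3 =>
      pairCorrelation (perturbedNN ε α) (LongRangeIsing.criticalBeta (perturbedNN ε α)) 0 x ^ 2) :=
  perturbedNN_mem_bubbleBlind hε.le hα hα' (hasCriticalDecay_perturbedNN hε hα (by linarith))

/-- **The two routes blocked by the barrier, now unconditional**: no property of couplings upward-closed in
`J` (within ferromagnetic translation-invariant couplings) and implying a non-Gaussian critical smearing holds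
at `J_nn`; and no `ℓ¹_s`-local condition at `J_nn` (`s < 3/2`) satisfied by the nearby `J^{(ε,α)}` implies
non-Gaussianity (`no_monotone_route`, `no_open_route` fed with `PerturbativeTrivialityOnZ3_holds`).
[cite: Panis2023Triviality, Theorem 5.5 and Remark 5.4, p. 21] -/
theorem PerturbativeTrivialityOnZ3.no_monotone_route' (Φ : (Site 3 → Site 3 → ℝ) → Prop)
    (hmono : ∀ J J' : Site 3 → Site 3 → ℝ, (∀ x y, J x y ≤ J' x y) → (∀ x y, 0 ≤ J' x y) →
      (∀ a x y, J' (x + a) (y + a) = J' x y) → Φ J → Φ J')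
    (hΦ : ∀ J, Φ J → HasNonGaussianSmearingZ3 J) : ¬ Φ (nnCoupling 3) :=
  PerturbativeTrivialityOnZ3_holds.no_monotone_route Φ hmono hΦ

end Literature.Barriers.CriticalPhenomena

end
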